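import Mathlib
import HarnessLib

/-!
# Crux `NNLinearDegreeCofactorHard` (stmt-ValiantsHypothesis-23918), line `internal_cofactor`, stub S2b (ii):
# μ* = shedWord — PARAMETERS (pure arithmetic)

With `g = root16 N = ⌊⌊⌊⌊√N⌋^{1/2}⌋^{1/2}⌋^{1/2}⌋ ≈ N^{1/16}` the assembly takes fill `H = g¹²`, band width `w = g¹¹`, adaptive time
`E = N − 2(#R′ + H + w)` and rate `g / 32`.  This file proves the inequalities the assembly needs, for `g ≥ 4096`:
`root16_pow_le` / `lt_succ_root16_pow` (`g¹⁶ ≤ N < (g+1)¹⁶`), `le_root16` (monotonicity), `band_poly` (`1536 (N+1) N⁴ ≤ w⁸`),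
`fill_gt_band` (`4w + 4 ≤ 3H`), `fit` (`3H + 2w + 2#R′ ≤ N`), `rate_of_heart` (the heart's dichotomy ⇒ `2(g/32) + 5 ≤ tests + P′`),
`rate_growth` (`M < (64 (g/32 + 1))¹⁶` when `2M < (g+1)¹⁶`).

Honest framing: arithmetic only; nothing here proves S2b, the crux or VP ≠ VNP (not proved).  One definition (`root16`). [folklore]
-/

-- Sub = Summit single-conjunct layout: the duplicated namespace component is mandated by the tree.
set_option linter.dupNamespace false

namespace Summit.ValiantsHypothesis.ValiantsHypothesis.Theorems.FifoMatching.NNLinearDegreeCofactorHard.ShedWord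

/-- `root16 N ≈ N^{1/16}`: four nested integer square roots. [folklore] -/
def root16 (N : ℕ) : ℕ := Nat.sqrt (Nat.sqrt (Nat.sqrt (Nat.sqrt N)))

/-- `(root16 N)¹⁶ ≤ N`. [folklore] -/
theorem root16_pow_le (N : ℕ) : root16 N ^ 16 ≤ N := by
  unfold root16
  have h1 := Nat.sqrt_le' N
  have h2 := Nat.sqrt_le' (Nat.sqrt N)
  have h3 := Nat.sqrt_le' (Nat.sqrt (Nat.sqrt N))
  have h4 := Nat.sqrt_le' (Nat.sqrt (Nat.sqrt (Nat.sqrt N)))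
  set a := Nat.sqrt N
  set b := Nat.sqrt a
  set c := Nat.sqrt b
  set d := Nat.sqrt c
  calc d ^ 16 = ((d ^ 2) ^ 2) ^ 2 ^ 2 := by ring
    _ ≤ ((c) ^ 2) ^ 2 ^ 2 := by gcongr
    _ = ((c ^ 2) ^ 2) ^ 2 := by ring
    _ ≤ ((b) ^ 2) ^ 2 := by gcongr
    _ ≤ (a) ^ 2 := by gcongr
    _ ≤ N := h1

/-- `N < (root16 N + 1)¹⁶`. [folklore] -/
theorem lt_succ_root16_pow (N : ℕ) : N < (root16 N + 1) ^ 16 := by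
  unfold root16
  have h1 := Nat.lt_succ_sqrt' N
  have h2 := Nat.lt_succ_sqrt' (Nat.sqrt N)
  have h3 := Nat.lt_succ_sqrt' (Nat.sqrt (Nat.sqrt N))
  have h4 := Nat.lt_succ_sqrt' (Nat.sqrt (Nat.sqrt (Nat.sqrt N)))
  set a := Nat.sqrt N
  set b := Nat.sqrt a
  set c := Nat.sqrt b
  set d := Nat.sqrt c
  -- `x < (y+1)^2` gives `x + 1 ≤ (y+1)^2`
  have e3 : c + 1 ≤ (d + 1) ^ 2 := h4
  have e2 : b + 1 ≤ (c + 1) ^ 2 := h3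
  have e1 : a + 1 ≤ (b + 1) ^ 2 := h2
  have e0 : N + 1 ≤ (a + 1) ^ 2 := h1
  have : N + 1 ≤ (d + 1) ^ 16 :=
    calc N + 1 ≤ (a + 1) ^ 2 := e0
      _ ≤ ((b + 1) ^ 2) ^ 2 := by gcongr
      _ ≤ (((c + 1) ^ 2) ^ 2) ^ 2 := by gcongr
      _ ≤ ((((d + 1) ^ 2) ^ 2) ^ 2) ^ 2 := by gcongr
      _ = (d + 1) ^ 16 := by ring
  omega

/-- Monotonicity: `G¹⁶ ≤ N ⇒ G ≤ root16 N`. [folklore] -/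
theorem le_root16 {G N : ℕ} (h : G ^ 16 ≤ N) : G ≤ root16 N := by
  unfold root16
  have e : G ^ 16 = (((G * G) * (G * G)) * ((G * G) * (G * G))) * (((G * G) * (G * G)) * ((G * G) * (G * G))) := by ring
  rw [e] at h
  have h1 := Nat.sqrt_le_sqrt h
  rw [Nat.sqrt_eq] at h1
  have h2 := Nat.sqrt_le_sqrt h1
  rw [Nat.sqrt_eq] at h2
  have h3 := Nat.sqrt_le_sqrt h2
  rw [Nat.sqrt_eq] at h3
  have h4 := Nat.sqrt_le_sqrt h3
  rw [Nat.sqrt_eq] at h4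
  exact h4

/-- `N < 2¹⁶ g¹⁶` for `g = root16 N ≥ 1`. [folklore] -/
theorem lt_two_pow_mul_root16_pow {N : ℕ} (hg : 1 ≤ root16 N) : N < 2 ^ 16 * root16 N ^ 16 := by
  have h := lt_succ_root16_pow N
  have h2 : (root16 N + 1) ^ 16 ≤ (2 * root16 N) ^ 16 := Nat.pow_le_pow_left (by omega) 16
  rw [mul_pow] at h2
  omega

/-- **Band polynomial**: `1536 (N+1) N⁴ ≤ (g¹¹)⁸` for `g = root16 N ≥ 4096`. [folklore] -/
theorem band_poly {N : ℕ} (hg : 4096 ≤ root16 N) : 1536 * (N + 1) * N ^ 4 ≤ (root16 N ^ 11) ^ 8 := by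
  set g := root16 N with hgdef
  have hN := lt_two_pow_mul_root16_pow (N := N) (by omega)
  rw [← hgdef] at hN
  have hN1 : N + 1 ≤ 2 ^ 16 * g ^ 16 := hN
  have hN4 : N ^ 4 ≤ (2 ^ 16 * g ^ 16) ^ 4 := Nat.pow_le_pow_left hN.le 4
  have hg8 : 1536 * 2 ^ 80 ≤ g ^ 8 := by
    calc 1536 * 2 ^ 80 ≤ 4096 ^ 8 := by norm_num
      _ ≤ g ^ 8 := Nat.pow_le_pow_left hg 8
  calc 1536 * (N + 1) * N ^ 4 ≤ 1536 * (2 ^ 16 * g ^ 16) * (2 ^ 16 * g ^ 16) ^ 4 := by gcongr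
    _ = (1536 * 2 ^ 80) * g ^ 80 := by ring
    _ ≤ g ^ 8 * g ^ 80 := Nat.mul_le_mul_right _ hg8
    _ = (g ^ 11) ^ 8 := by ring

/-- **The band is narrower than the fill**: `4 g¹¹ + 4 ≤ 3 g¹²` (`g ≥ 2`). [folklore] -/
theorem fill_gt_band {g : ℕ} (hg : 2 ≤ g) : 4 * g ^ 11 + 4 ≤ 3 * g ^ 12 := by
  have h1 : g ^ 12 = g * g ^ 11 := by ring
  have h2 : 2 ≤ g ^ 11 := le_trans hg (Nat.le_self_pow (by norm_num) g)
  have h3 : 2 * g ^ 11 ≤ g * g ^ 11 := Nat.mul_le_mul_right _ hg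
  omega

/-- **Everything fits**: `3 g¹² + 2 g¹¹ + 2 #R′ ≤ N` for `g = root16 N ≥ 4096` and `1012 #R′ ≤ N + 4`. [folklore] -/
theorem fit {N Rc : ℕ} (hg : 4096 ≤ root16 N) (hRc : 1012 * Rc ≤ N + 4) :
    3 * root16 N ^ 12 + 2 * root16 N ^ 11 + 2 * Rc ≤ N := by
  set g := root16 N with hgdef
  have hN : g ^ 16 ≤ N := root16_pow_le N
  have h1 : g ^ 16 = g ^ 4 * g ^ 12 := by ring
  have h4 : 4096 ^ 4 ≤ g ^ 4 := Nat.pow_le_pow_left hg 4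
  have h2 : g ^ 11 ≤ g ^ 12 := Nat.pow_le_pow_right (by omega) (by norm_num)
  have h3 : 8 * g ^ 12 ≤ g ^ 16 := by
    rw [h1]
    exact Nat.mul_le_mul_right _ (le_trans (by norm_num) h4)
  omega

/-- **The rate from the heart.**  With `H = g¹²`, `w = g¹¹`, `3H ≤ 4F₀`, `F₀ ≤ H`, `1012 #R′ ≤ N + 4`, `g = root16 N ≥ 4096`, the
heart's dichotomy (free-mass deficit `≤ (F₀ + w) P′`, or `F₀ − w ≤ tests + 2w(2P′ + 1)`) gives `2 (g/32) + 5 ≤ tests + P′`. [folklore] -/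
theorem rate_of_heart {N Rc F₀ P T : ℕ} (hg : 4096 ≤ root16 N) (hRc : 1012 * Rc ≤ N + 4)
    (hF₀l : 3 * root16 N ^ 12 ≤ 4 * F₀) (hF₀u : F₀ ≤ root16 N ^ 12)
    (hheart : N / 6 - 2 * Rc - 2 * (Rc + root16 N ^ 12 + root16 N ^ 11) - root16 N ^ 12 - 2 * F₀ - 6 * root16 N ^ 11 ≤
        (F₀ + root16 N ^ 11) * P ∨
      F₀ - root16 N ^ 11 ≤ T + 2 * root16 N ^ 11 * (2 * P + 1)) :
    2 * (root16 N / 32) + 5 ≤ T + P := by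
  set g := root16 N with hgdef
  have hN : g ^ 16 ≤ N := root16_pow_le N
  have e16 : g ^ 16 = g ^ 4 * g ^ 12 := by ring
  have e12 : g ^ 12 = g * g ^ 11 := by ring
  have h4 : 4096 ^ 4 ≤ g ^ 4 := Nat.pow_le_pow_left hg 4
  have hg11 : 0 < g ^ 11 := Nat.pow_pos (by omega)
  have hg12 : 0 < g ^ 12 := Nat.pow_pos (by omega)
  have h1112 : g ^ 11 ≤ g ^ 12 := Nat.pow_le_pow_right (by omega) (by norm_num)
  rcases hheart with h | h
  · -- Case 1: the deficit is at least `g^16 / 8`, and `F₀ + w ≤ 2 g^12`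
    have hbig : 2 ^ 48 * g ^ 12 ≤ g ^ 16 := by
      rw [e16]; exact Nat.mul_le_mul_right _ (le_trans (by norm_num) h4)
    have hdef : g ^ 16 / 8 ≤ (F₀ + g ^ 11) * P := by omega
    have hP : g ^ 4 / 16 ≤ P := by
      by_contra hlt
      rw [not_le] at hlt
      have : (F₀ + g ^ 11) * P < g ^ 16 / 8 := by
        calc (F₀ + g ^ 11) * P ≤ (2 * g ^ 12) * P := Nat.mul_le_mul_right _ (by omega)
          _ < (2 * g ^ 12) * (g ^ 4 / 16) := Nat.mul_lt_mul_of_pos_left hlt (by omega)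
          _ ≤ g ^ 16 / 8 := by
            rw [e16, Nat.le_div_iff_mul_le (by norm_num)]
            have := Nat.div_mul_le_self (g ^ 4) 16
            nlinarith
      omega
    have hg4 : 16 * (g / 16 + 5) * 16 ≤ g ^ 4 := by
      have e4 : g ^ 4 = g * g * g * g := by ring
      have hA : 16 * (g / 16 + 5) * 16 ≤ 16 * g + 1280 := by omega
      have hB : 16 * g + 1280 ≤ g * g := by nlinarith
      have hC : g * g ≤ g * g * g * g := by
        calc g * g = g * g * 1 * 1 := by ring
          _ ≤ g * g * g * g := by gcongr <;> omega
      rw [e4]; omega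
    have : g / 16 + 5 ≤ g ^ 4 / 16 := by
      rw [Nat.le_div_iff_mul_le (by norm_num)]
      nlinarith
    omega
  · -- Case 2: `4 w (T + P) ≥ 3H/4 − 3w ≥ w · (g / 2)`
    have h2 : F₀ ≤ T + 4 * g ^ 11 * P + 3 * g ^ 11 := by
      have : 2 * g ^ 11 * (2 * P + 1) = 4 * g ^ 11 * P + 2 * g ^ 11 := by ring
      omega
    -- `3 g^12 ≤ 4 F₀ ≤ 4T + 16 g^11 P + 12 g^11`, and `T ≤ g^11 T`
    have h3 : 3 * g ^ 12 ≤ 4 * g ^ 11 * T + 16 * g ^ 11 * P + 12 * g ^ 11 := by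
      have hT : T ≤ g ^ 11 * T := Nat.le_mul_of_pos_left T hg11
      nlinarith
    have h4' : g ^ 11 * (3 * g) ≤ g ^ 11 * (4 * T + 16 * P + 12) := by
      have : g ^ 11 * (3 * g) = 3 * g ^ 12 := by rw [e12]; ring
      rw [this]
      calc 3 * g ^ 12 ≤ 4 * g ^ 11 * T + 16 * g ^ 11 * P + 12 * g ^ 11 := h3
        _ = g ^ 11 * (4 * T + 16 * P + 12) := by ring
    have h5 : 3 * g ≤ 4 * T + 16 * P + 12 := Nat.le_of_mul_le_mul_left h4' hg11
    omega

/-- **Rate growth**: `M < (64 (g/32 + 1))¹⁶` whenever `M ≤ N < (g+1)¹⁶`. [folklore] -/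
theorem rate_growth {M N : ℕ} (hMN : M ≤ N) : M < (64 * (root16 N / 32 + 1)) ^ 16 := by
  have h := lt_succ_root16_pow N
  have h2 : root16 N + 1 ≤ 64 * (root16 N / 32 + 1) := by omega
  have h3 := Nat.pow_le_pow_left h2 16
  omega

end Summit.ValiantsHypothesis.ValiantsHypothesis.Theorems.FifoMatching.NNLinearDegreeCofactorHard.ShedWord
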